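import Literature.MathematicalPhysics.QuantumLattice.PairedProductStates
import Literature.MathematicalPhysics.QuantumLattice.PatchPairOperator
import HarnessLib

/-!
# The `d`-wave pair field on paired vectors: Coleman's geminal-power norm, lower bound

Topic `MathematicalPhysics/QuantumLattice`, family `hubbard` (written for route `IsoperimetricCascade`,
support `FlatAGPNormGrowth`, stmt-HubbardSuperconductivity-11982).

Coleman's geminal-power norm, LOWER bound by a single paired configuration. In momentum space the
`d`-wave pair field is `Δ = -Σ_k w_k b_k` (`pairField_eq_neg_sum_pairFieldMode_smul_pairMode`,
`w_k = pairFieldMode dWaveFormFactor L k = 2√2 (cos p₁ - cos p₂)`), with hard-core-boson pair modes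
`b_k = c_{-k↓} c_{k↑}`. On the paired vectors `Φ_S = Π_{k∈S} b†_k |∅⟩` of `PairedProductStates`:

* `pairField_mulVec_paired` — `Δ Φ_S = Σ_{k∈S} (-w_k) Φ_{S∖k}`;
* `vacuum_dotProduct_pow_pairField_mulVec_paired` — hence the vacuum component of `Δ^m Φ_S` is
  `[|S| = m] · m! · Π_{k∈S} (-w_k)` (each removal order contributes once);
* `norm_sq_pow_conjTranspose_pairField_vacuum_ge` — by Cauchy–Schwarz against the unit vector `Φ_S`,
  **`‖(Δᴴ)ⁿ|∅⟩‖² ≥ (n!)² Π_{k∈S} w_k²`** for every `n`-set `S` of momenta.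

Sources: A. J. Coleman, J. Math. Phys. 6 (1965) 1425, §§3–5 (AGP norms, `(n!)² e_n`); J. von Delft,
D. C. Ralph, Phys. Rep. 345 (2001) 61, §4.2.3 (hard-core-boson pair operators). No definition is
introduced (the paired vectors are written out as literal terms, as in `PairedProductStates`).
-/

namespace Literature.MathematicalPhysics.QuantumLattice

open Matrix Finset
open Literature.Probability.LatticeModels

variable {L : ℕ} [NeZero L]

/-! ### The pair field on paired vectors -/

/-- Removing the mode `k ∈ S` from the paired vector: `Φ_S = b†_k Φ_{S∖k}`. [folklore] -/
theorem paired_toList_eq_cons {S : Finset (TorusSite 2 L)} {k : TorusSite 2 L} (hk : k ∈ S) :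
    ((List.map (fun k : TorusSite 2 L => (pairMode k)ᴴ) S.toList).prod *ᵥ
      (vacuum : Fock (Orb (FermionTorus 2 L)))) = (pairMode k)ᴴ *ᵥ ((List.map (fun k : TorusSite 2 L => (pairMode k)ᴴ) (S.erase k).toList).prod *ᵥ
      (vacuum : Fock (Orb (FermionTorus 2 L)))) := by
  have hperm : S.toList.Perm (k :: (S.erase k).toList) := by
    rw [List.perm_ext_iff_of_nodup (Finset.nodup_toList S)
      (List.nodup_cons.2 ⟨by rw [Finset.mem_toList]; exact Finset.notMem_erase k S,
        Finset.nodup_toList _⟩)]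
    intro a
    rw [Finset.mem_toList, List.mem_cons, Finset.mem_toList, Finset.mem_erase]
    constructor
    · intro ha
      by_cases hak : a = k
      · exact Or.inl hak
      · exact Or.inr ⟨hak, ha⟩
    · rintro (rfl | ⟨-, ha⟩)
      · exact hk
      · exact ha
  rw [pairedState_perm hperm, pairedState_cons]

/-- `b_k Φ_S = Φ_{S∖k}` for `k ∈ S` and `b_k Φ_S = 0` for `k ∉ S`. [folklore] -/
theorem pairMode_mulVec_paired (S : Finset (TorusSite 2 L)) (k : TorusSite 2 L) :
    pairMode k *ᵥ ((List.map (fun k : TorusSite 2 L => (pairMode k)ᴴ) S.toList).prod *ᵥ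
      (vacuum : Fock (Orb (FermionTorus 2 L)))) = if k ∈ S then ((List.map (fun k : TorusSite 2 L => (pairMode k)ᴴ) (S.erase k).toList).prod *ᵥ
      (vacuum : Fock (Orb (FermionTorus 2 L)))) else 0 := by
  by_cases hk : k ∈ S
  · rw [if_pos hk, paired_toList_eq_cons hk, pairMode_pairMode_conjTranspose_pairedState_of_not_mem]
    rw [Finset.mem_toList]
    exact Finset.notMem_erase k S
  · rw [if_neg hk, pairMode_pairedState_of_not_mem]
    rwa [Finset.mem_toList]

/-- **The pair field lowers a paired vector mode by mode**:
`Δ Φ_S = Σ_{k∈S} (-w_k) Φ_{S∖k}`, `w = pairFieldMode dWaveFormFactor L`. [folklore] -/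
theorem pairField_mulVec_paired (S : Finset (TorusSite 2 L)) :
    pairField dWaveFormFactor L *ᵥ ((List.map (fun k : TorusSite 2 L => (pairMode k)ᴴ) S.toList).prod *ᵥ
      (vacuum : Fock (Orb (FermionTorus 2 L)))) =
      ∑ k ∈ S, (-(pairFieldMode dWaveFormFactor L k : ℂ)) • ((List.map (fun k : TorusSite 2 L => (pairMode k)ᴴ) (S.erase k).toList).prod *ᵥ
      (vacuum : Fock (Orb (FermionTorus 2 L)))) := by
  rw [pairField_eq_neg_sum_pairFieldMode_smul_pairMode, neg_mulVec, sum_mulVec,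
    ← Finset.sum_neg_distrib, ← Finset.sum_subset (Finset.subset_univ S)]
  · refine Finset.sum_congr rfl fun k hk => ?_
    rw [smul_mulVec, pairMode_mulVec_paired, if_pos hk, neg_smul]
  · intro k _ hk
    rw [smul_mulVec, pairMode_mulVec_paired, if_neg hk, smul_zero, neg_zero]

/-- `b_k |∅⟩ = 0`. [folklore] -/
theorem pairMode_mulVec_vacuum (k : TorusSite 2 L) :
    pairMode k *ᵥ (vacuum : Fock (Orb (FermionTorus 2 L))) = 0 := by
  rw [pairMode, ← mulVec_mulVec, momentumAnnihilation_mulVec_vacuum, mulVec_zero]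

/-- The vacuum is orthogonal to every nonempty paired vector, and `⟨∅|Φ_∅⟩ = 1`:
`⟨∅|Φ_S⟩ = [S = ∅]`. [folklore] -/
theorem vacuum_dotProduct_paired (S : Finset (TorusSite 2 L)) :
    star (vacuum : Fock (Orb (FermionTorus 2 L))) ⬝ᵥ ((List.map (fun k : TorusSite 2 L => (pairMode k)ᴴ) S.toList).prod *ᵥ
      (vacuum : Fock (Orb (FermionTorus 2 L)))) = if S = ∅ then 1 else 0 := by
  by_cases hS : S = ∅
  · rw [if_pos hS, hS, Finset.toList_empty, pairedState_nil, star_vacuum_dotProduct_vacuum]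
  · obtain ⟨k, hk⟩ := Finset.nonempty_iff_ne_empty.2 hS
    rw [if_neg hS, paired_toList_eq_cons hk, dotProduct_mulVec, ← star_mulVec, pairMode_mulVec_vacuum,
      star_zero, zero_dotProduct]

/-- **The vacuum component of `Δ^m Φ_S`** is `[|S| = m] · m! · Π_{k∈S} (-w_k)`: expanding
`Δ^m` mode by mode, exactly the `m!` removal orders of the `m` modes of `S` reach the vacuum.
[cite: Coleman1965, §3] -/
theorem vacuum_dotProduct_pow_pairField_mulVec_paired (m : ℕ) :
    ∀ S : Finset (TorusSite 2 L),
      star (vacuum : Fock (Orb (FermionTorus 2 L))) ⬝ᵥ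
          ((pairField dWaveFormFactor L) ^ m *ᵥ ((List.map (fun k : TorusSite 2 L => (pairMode k)ᴴ) S.toList).prod *ᵥ
      (vacuum : Fock (Orb (FermionTorus 2 L))))) =
        if S.card = m then (m.factorial : ℂ) * ∏ k ∈ S, (-(pairFieldMode dWaveFormFactor L k : ℂ))
        else 0 := by
  induction m with
  | zero =>
    intro S
    rw [pow_zero, one_mulVec, vacuum_dotProduct_paired, Nat.factorial_zero, Nat.cast_one, one_mul]
    by_cases hS : S = ∅
    · rw [if_pos hS, if_pos (Finset.card_eq_zero.2 hS), hS, Finset.prod_empty]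
    · rw [if_neg hS, if_neg (fun h => hS (Finset.card_eq_zero.1 h))]
  | succ m ih =>
    intro S
    rw [pow_succ, ← mulVec_mulVec, pairField_mulVec_paired, Matrix.mulVec_sum, dotProduct_sum]
    have hterm : ∀ k ∈ S, star (vacuum : Fock (Orb (FermionTorus 2 L))) ⬝ᵥ
        ((pairField dWaveFormFactor L) ^ m *ᵥ
          ((-(pairFieldMode dWaveFormFactor L k : ℂ)) • ((List.map (fun k : TorusSite 2 L => (pairMode k)ᴴ) (S.erase k).toList).prod *ᵥ
      (vacuum : Fock (Orb (FermionTorus 2 L)))))) =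
        if S.card = m + 1 then
          (m.factorial : ℂ) * ∏ j ∈ S, (-(pairFieldMode dWaveFormFactor L j : ℂ)) else 0 := by
      intro k hk
      rw [mulVec_smul, dotProduct_smul, ih (S.erase k), Finset.card_erase_of_mem hk, smul_eq_mul]
      have hcard : S.card - 1 = m ↔ S.card = m + 1 := by
        have := Finset.card_pos.2 ⟨k, hk⟩
        omega
      by_cases hc : S.card = m + 1
      · rw [if_pos (hcard.2 hc), if_pos hc, ← Finset.mul_prod_erase S _ hk]
        ring
      · rw [if_neg (fun h => hc (hcard.1 h)), if_neg hc, mul_zero]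
    rw [Finset.sum_congr rfl hterm, Finset.sum_const, nsmul_eq_mul]
    by_cases hc : S.card = m + 1
    · rw [if_pos hc, if_pos hc, hc, Nat.factorial_succ, Nat.cast_mul, Nat.cast_succ]
      ring
    · rw [if_neg hc, if_neg hc]
      simp

/-! ### The lower bound by one paired configuration -/

/-- `|⟨x, y⟩|² ≤ Re⟨x,x⟩ · Re⟨y,y⟩` for the dot-product pairing `star · ⬝ᵥ ·` (Cauchy–Schwarz in
`ℓ²`). [folklore] -/
theorem norm_sq_star_dotProduct_le {ι : Type*} [Fintype ι] (x y : ι → ℂ) :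
    ‖star x ⬝ᵥ y‖ ^ 2 ≤ (star x ⬝ᵥ x).re * (star y ⬝ᵥ y).re := by
  have hin : ∀ p q : ι → ℂ,
      inner ℂ (WithLp.toLp 2 p : EuclideanSpace ℂ ι) (WithLp.toLp 2 q) = star p ⬝ᵥ q := by
    intro p q
    rw [EuclideanSpace.inner_eq_star_dotProduct, dotProduct_comm]
  have hnn : ∀ p : ι → ℂ, ‖(WithLp.toLp 2 p : EuclideanSpace ℂ ι)‖ ^ 2 = (star p ⬝ᵥ p).re := by
    intro p
    rw [← hin, ← inner_self_eq_norm_sq (𝕜 := ℂ)]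
    rfl
  rw [← hin, ← hnn, ← hnn, ← mul_pow]
  gcongr
  exact norm_inner_le_norm _ _

/-- **Coleman's geminal-power norm, lower bound by one configuration**: for every `n`-set `S` of
momenta, `(n!)² Π_{k∈S} w_k² ≤ ‖(Δᴴ)ⁿ|∅⟩‖²` (`w = pairFieldMode dWaveFormFactor L`).
[cite: Coleman1965, §§3–5] -/
theorem norm_sq_pow_conjTranspose_pairField_vacuum_ge (S : Finset (TorusSite 2 L)) :
    ((S.card.factorial : ℝ) * ∏ k ∈ S, |pairFieldMode dWaveFormFactor L k|) ^ 2 ≤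
      (star ((pairField dWaveFormFactor L)ᴴ ^ S.card *ᵥ (vacuum : Fock (Orb (FermionTorus 2 L)))) ⬝ᵥ
        ((pairField dWaveFormFactor L)ᴴ ^ S.card *ᵥ (vacuum : Fock (Orb (FermionTorus 2 L))))).re := by
  set Ψ := (pairField dWaveFormFactor L)ᴴ ^ S.card *ᵥ (vacuum : Fock (Orb (FermionTorus 2 L))) with hΨ
  -- the overlap with `Φ_S` is the (conjugate of the) vacuum component of `Δⁿ Φ_S`
  have hov : star (((List.map (fun k : TorusSite 2 L => (pairMode k)ᴴ) S.toList).prod *ᵥ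
      (vacuum : Fock (Orb (FermionTorus 2 L))))) ⬝ᵥ Ψ =
      star ((S.card.factorial : ℂ) * ∏ k ∈ S, (-(pairFieldMode dWaveFormFactor L k : ℂ))) := by
    have h1 : star ((pairField dWaveFormFactor L) ^ S.card *ᵥ ((List.map (fun k : TorusSite 2 L => (pairMode k)ᴴ) S.toList).prod *ᵥ
      (vacuum : Fock (Orb (FermionTorus 2 L))))) =
        star (((List.map (fun k : TorusSite 2 L => (pairMode k)ᴴ) S.toList).prod *ᵥ
      (vacuum : Fock (Orb (FermionTorus 2 L))))) ᵥ* (pairField dWaveFormFactor L)ᴴ ^ S.card := by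
      rw [star_mulVec, conjTranspose_pow]
    rw [hΨ, dotProduct_mulVec, ← h1, star_dotProduct, vacuum_dotProduct_pow_pairField_mulVec_paired,
      if_pos rfl]
  have hnorm : ‖star (((List.map (fun k : TorusSite 2 L => (pairMode k)ᴴ) S.toList).prod *ᵥ
      (vacuum : Fock (Orb (FermionTorus 2 L))))) ⬝ᵥ Ψ‖ =
      (S.card.factorial : ℝ) * ∏ k ∈ S, |pairFieldMode dWaveFormFactor L k| := by
    rw [hov, norm_star, norm_mul, Complex.norm_natCast, norm_prod]
    congr 1
    refine Finset.prod_congr rfl fun k _ => ?_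
    rw [norm_neg, Complex.norm_real, Real.norm_eq_abs]
  have hunit : (star (((List.map (fun k : TorusSite 2 L => (pairMode k)ᴴ) S.toList).prod *ᵥ
      (vacuum : Fock (Orb (FermionTorus 2 L))))) ⬝ᵥ ((List.map (fun k : TorusSite 2 L => (pairMode k)ᴴ) S.toList).prod *ᵥ
      (vacuum : Fock (Orb (FermionTorus 2 L))))).re = 1 := by
    rw [star_pairedState_dotProduct_self (Finset.nodup_toList S), Complex.one_re]
  have hcs := norm_sq_star_dotProduct_le (((List.map (fun k : TorusSite 2 L => (pairMode k)ᴴ) S.toList).prod *ᵥ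
      (vacuum : Fock (Orb (FermionTorus 2 L))))) Ψ
  rw [hnorm, hunit, one_mul] at hcs
  exact hcs

end Literature.MathematicalPhysics.QuantumLattice
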